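import Summits.Ventures.Crystal3D.Theorems.StickyWulffConstantCoaxialWallLawHexCapCount
import HarnessLib

/-!
# The laminar local law: a ball of a filling supported on the common basal planes has at most six contacts outside its own layer

HONEST FRAMING. Part of the venture `Summits/Ventures/Crystal3D` (cell `crystal3d-full`), helper
`--supports` the crux `CoaxialWallLaw` (stmt-Ventures-19481, `route-Ventures-StickyWulffConstant`),
REGISTERED line `WallLedgerF` (planner cf-p1 gen 16), open stub `stub_coaxialTwoSlabAdhesion`.
RUNG CREDIT ONLY; F-C1 not moved.  First brick of a LAMINAR rung (next seat): the class of fillings whose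
balls all lie in the basal planes `⟪L⁻¹(p − s), e₃⟫ ∈ √(2/3)·ℤ` of the shared frame — arbitrary IN-PLANE
positions (in-layer relaxations, 2D disorder), a strict superset of the on-site class of `…CoaxialWallLawLayered`.

* **`laminar_card_contacts_le`** — `X` `1`-separated and laminar for the frame `(L, s)`; then every ball `z ∈ X` has
  `deg z ≤ #{contacts of z in its own layer} + 6`: a contact in another layer is exactly one layer away (two
  layers are `2√(2/3) > 1` apart), hence a unit vector `u` with `⟪u, L e₃⟫² = 2/3`; such vectors pairwise at
  `⟪u, u'⟫ ≤ ½` are at most THREE per side (`card_le_three_of_polarCap`).  So `12 − deg z ≥ 6 − deg₂ z`, the 2D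
  deficiency of `z` in its layer: the laminar rung reduces the wall to the 2D crystallisation count of its layers
  (at an in-plane run end `deg₂ ≤ 5` by the 2D kissing rigidity — next file).

WHAT THIS IS NOT: no 2D rigidity, no count; F-C1 not moved.
-/

noncomputable section

namespace Summit.Ventures.Crystal3D.Theorems

open Summit.Ventures.Crystal3D Finset
open scoped InnerProductSpace

open scoped Classical in
/-- **The laminar local law.**  See the module docstring. -/
theorem laminar_card_contacts_le
    (L : EuclideanSpace ℝ (Fin 3) ≃ₗᵢ[ℝ] EuclideanSpace ℝ (Fin 3)) (s : EuclideanSpace ℝ (Fin 3))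
    (X : Finset (EuclideanSpace ℝ (Fin 3)))
    (hX : ∀ p ∈ X, ∀ q ∈ X, p ≠ q → 1 ≤ dist p q)
    (hlam : ∀ p ∈ X, ∃ k : ℤ, (L.symm (p - s)) 2 = k * Real.sqrt (2 / 3))
    {z : EuclideanSpace ℝ (Fin 3)} (hz : z ∈ X) :
    (X.filter fun q => dist z q = 1).card ≤
      (X.filter fun q => dist z q = 1 ∧ (L.symm (q - s)) 2 = (L.symm (z - s)) 2).card + 6 := by
  set e₃ : EuclideanSpace ℝ (Fin 3) := EuclideanSpace.single (2 : Fin 3) (1 : ℝ) with he₃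
  set n : EuclideanSpace ℝ (Fin 3) := L e₃ with hn
  set C : Finset (EuclideanSpace ℝ (Fin 3)) := X.filter fun q => dist z q = 1 with hC
  have he₃1 : ‖e₃‖ = 1 := by rw [he₃, PiLp.norm_single, norm_one]
  have hn1 : ‖n‖ = 1 := by rw [hn, LinearIsometryEquiv.norm_map, he₃1]
  have hH : Real.sqrt (2 / 3) ^ 2 = 2 / 3 := Real.sq_sqrt (by norm_num)
  have hs0 : 0 < Real.sqrt (2 / 3) := Real.sqrt_pos.2 (by norm_num)
  obtain ⟨kz, hkz⟩ := hlam z hz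
  -- the frame height of a contact relative to `z`
  have hheight : ∀ q : EuclideanSpace ℝ (Fin 3), ⟪q - z, n⟫_ℝ = (L.symm (q - s)) 2 - (L.symm (z - s)) 2 := by
    intro q
    have e : q - z = L (L.symm (q - s) - L.symm (z - s)) := by
      rw [map_sub, LinearIsometryEquiv.apply_symm_apply, LinearIsometryEquiv.apply_symm_apply]; abel
    rw [e, hn, LinearIsometryEquiv.inner_map_map, EuclideanSpace.inner_single_right, PiLp.sub_apply]
    simp
  -- for a contact: the layer jump is `-1`, `0` or `1`, and `⟪q − z, n⟫ = jump · √(2/3)`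
  have hjump : ∀ q ∈ C, ∃ m : ℤ, (m = 0 ∨ m = 1 ∨ m = -1) ∧ ⟪q - z, n⟫_ℝ = m * Real.sqrt (2 / 3) := by
    intro q hq
    rw [hC, mem_filter] at hq
    obtain ⟨hqX, hqd⟩ := hq
    obtain ⟨kq, hkq⟩ := hlam q hqX
    refine ⟨kq - kz, ?_, by rw [hheight, hkq, hkz]; push_cast; ring⟩
    have hu1 : ‖q - z‖ = 1 := by rw [← dist_eq_norm, dist_comm, hqd]
    have hle : |⟪q - z, n⟫_ℝ| ≤ 1 := by
      have := abs_real_inner_le_norm (q - z) n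
      rw [hu1, hn1, one_mul] at this
      exact this
    rw [hheight, hkq, hkz, show (kq : ℝ) * Real.sqrt (2 / 3) - kz * Real.sqrt (2 / 3) =
      ((kq - kz : ℤ) : ℝ) * Real.sqrt (2 / 3) by push_cast; ring, abs_mul, abs_of_pos hs0] at hle
    have hm : |((kq - kz : ℤ) : ℝ)| ≤ 3 / 2 := by
      by_contra hgt
      push Not at hgt
      have : (3 / 2 : ℝ) * Real.sqrt (2 / 3) < |((kq - kz : ℤ) : ℝ)| * Real.sqrt (2 / 3) :=
        mul_lt_mul_of_pos_right hgt hs0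
      nlinarith [hH, hs0]
    have h4 : ((kq - kz : ℤ) : ℝ) ≤ 3 / 2 := (le_abs_self _).trans hm
    have h5 : -(3 / 2 : ℝ) ≤ ((kq - kz : ℤ) : ℝ) := by linarith [neg_abs_le (((kq - kz : ℤ)) : ℝ)]
    have h6 : kq - kz ≤ 1 := by
      by_contra h7
      push Not at h7
      have : (2 : ℝ) ≤ ((kq - kz : ℤ) : ℝ) := by exact_mod_cast h7
      linarith
    have h8 : -1 ≤ kq - kz := by
      by_contra h7
      push Not at h7
      have : ((kq - kz : ℤ) : ℝ) ≤ -2 := by exact_mod_cast (show kq - kz ≤ -2 by omega)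
      linarith
    omega
  -- split by layer
  set C0 := C.filter fun q => ⟪q - z, n⟫_ℝ = 0 with hC0
  set Cp := C.filter fun q => 0 < ⟪q - z, n⟫_ℝ with hCp
  set Cm := C.filter fun q => ⟪q - z, n⟫_ℝ < 0 with hCm
  have hsplit : C ⊆ C0 ∪ Cp ∪ Cm := by
    intro q hq
    rcases lt_trichotomy 0 ⟪q - z, n⟫_ℝ with h | h | h
    · exact mem_union_left _ (mem_union_right _ (mem_filter.2 ⟨hq, h⟩))
    · exact mem_union_left _ (mem_union_left _ (mem_filter.2 ⟨hq, h.symm⟩))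
    · exact mem_union_right _ (mem_filter.2 ⟨hq, h⟩)
  have hcardC : C.card ≤ C0.card + Cp.card + Cm.card :=
    (card_le_card hsplit).trans ((card_union_le _ _).trans (by
      have := card_union_le C0 Cp; omega))
  -- (1) same layer
  have hC0 : C0.card ≤ (X.filter fun q => dist z q = 1 ∧ (L.symm (q - s)) 2 = (L.symm (z - s)) 2).card := by
    refine card_le_card ?_
    intro q hq
    rw [hC0, mem_filter, hC, mem_filter] at hq
    rw [mem_filter]
    refine ⟨hq.1.1, hq.1.2, ?_⟩
    have := hheight q
    rw [hq.2] at this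
    linarith
  -- (2), (3): the caps
  have hcap : ∀ (m : EuclideanSpace ℝ (Fin 3)), (m = n ∨ m = -n) →
      ((C.filter fun q => 0 < ⟪q - z, m⟫_ℝ).card ≤ 3) := by
    intro m hm
    have hm1 : ‖m‖ = 1 := by rcases hm with rfl | rfl; exact hn1; rw [norm_neg, hn1]
    set Cq := C.filter fun q => 0 < ⟪q - z, m⟫_ℝ with hCq
    have hinj : Set.InjOn (fun q => q - z) ↑Cq := by
      intro q _ q' _ hqq'; simpa using hqq'
    rw [← card_image_of_injOn hinj]
    refine card_le_three_of_polarCap hm1 _ ?_ ?_ ?_ ?_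
    · intro u hu
      obtain ⟨q, hq, rfl⟩ := mem_image.1 hu
      have hqC := (mem_filter.1 hq).1
      rw [hC, mem_filter] at hqC
      rw [← dist_eq_norm, dist_comm]; exact hqC.2
    · intro u hu
      obtain ⟨q, hq, rfl⟩ := mem_image.1 hu
      exact (mem_filter.1 hq).2
    · intro u hu
      obtain ⟨q, hq, rfl⟩ := mem_image.1 hu
      obtain ⟨hqC, hpos⟩ := mem_filter.1 hq
      obtain ⟨j, hj, hinner⟩ := hjump q hqC
      have hmn : ⟪q - z, m⟫_ℝ ^ 2 = ⟪q - z, n⟫_ℝ ^ 2 := by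
        rcases hm with rfl | rfl
        · rfl
        · rw [inner_neg_right, neg_sq]
      rw [hmn, hinner]
      have hj0 : j ≠ 0 := by
        rintro rfl
        have : ⟪q - z, m⟫_ℝ = 0 := by
          rcases hm with rfl | rfl
          · rw [hinner]; simp
          · rw [inner_neg_right, hinner]; simp
        rw [this] at hpos; exact lt_irrefl _ hpos
      have hj1 : (j : ℝ) ^ 2 = 1 := by
        rcases hj with h | h | h
        · exact absurd h hj0
        · rw [h]; norm_num
        · rw [h]; norm_num
      nlinarith [hj1, hH]
    · intro u hu u' hu' huu'
      obtain ⟨q, hq, rfl⟩ := mem_image.1 hu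
      obtain ⟨q', hq', rfl⟩ := mem_image.1 hu'
      have hqC := (mem_filter.1 hq).1
      have hq'C := (mem_filter.1 hq').1
      rw [hC, mem_filter] at hqC hq'C
      have hne : q ≠ q' := fun h => huu' (by rw [h])
      have hd := hX q hqC.1 q' hq'C.1 hne
      have hu1 : ‖q - z‖ = 1 := by rw [← dist_eq_norm, dist_comm, hqC.2]
      have hu1' : ‖q' - z‖ = 1 := by rw [← dist_eq_norm, dist_comm, hq'C.2]
      have hdd : dist q q' = ‖(q - z) - (q' - z)‖ := by rw [dist_eq_norm]; congr 1; abel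
      have hexp : ‖(q - z) - (q' - z)‖ ^ 2 = ‖q - z‖ ^ 2 - 2 * ⟪q - z, q' - z⟫_ℝ + ‖q' - z‖ ^ 2 :=
        norm_sub_sq_real _ _
      rw [hu1, hu1', ← hdd] at hexp
      nlinarith [hexp, hd]
  have hCp : Cp.card ≤ 3 := hcap n (Or.inl rfl)
  have hCm : Cm.card ≤ 3 := by
    have h := hcap (-n) (Or.inr rfl)
    have hEq : Cm = C.filter fun q => 0 < ⟪q - z, -n⟫_ℝ := by
      rw [hCm]; congr 1; ext q; rw [inner_neg_right]; constructor <;> intro h' <;> linarith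
    rw [hEq]; exact h
  omega

end Summit.Ventures.Crystal3D.Theorems

end
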